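import Mathlib.Data.List.Rotate
import Literature.Combinatorics.SimpleGraph.HamiltonianCycleListings
import HarnessLib

/-!
# Subdividing a forced edge preserves (non-)Hamiltonicity; iterated padding

Support file for the discharge of
`Literature.ModelTheory.FiniteModelTheory.AtseriasDawarOchremiak2021_hamiltonicity_countingWidth`,
where hard pairs of graphs have to be produced on EVERY large number of vertices: the gadget graphs come
in sizes `3(5n + 93m + 2)`, and the gaps are filled by subdividing one edge of the graph repeatedly.

* `IsHamCycleListing.rotate`, `IsHamCycleListing.exists_rotate_eq_concat`, `isHamCycleListing_concat_iff`
  — cyclic listings (`HamiltonianCycleListings.lean`) may be rotated so that a chosen vertex comes last,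
  and a listing `L ++ [z]` is a path `L` closed up through `z`.
* `subdivide G a c` — the graph on `Option α` obtained from `G` by subdividing the edge `a — c` with the
  new vertex `none`.
* `isHamiltonian_subdivide_iff` — if `a — c` is an edge and `a` has exactly two neighbours (`c` and
  `a'`), then `subdivide G a c` is Hamiltonian iff `G` is (a Hamiltonian cycle must use both edges at a
  degree-two vertex, so the edge `a — c` is on every Hamiltonian cycle; Garey–Johnson–Tarjan 1976, §2:
  "any Hamiltonian path must pass through each vertex of degree two").
* `PadV α r` (= `Option^r α`), `padGraph G a c r` — `r`-fold iterated subdivision (always at the newest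
  vertex, which has degree two), `card_padV`, and `isHamiltonian_padGraph_iff`.

## References

* M. R. Garey, D. S. Johnson, R. E. Tarjan, *The planar Hamiltonian circuit problem is NP-complete*,
  SIAM J. Comput. 5 (1976) 704–714, §2 (degree-two forcing).
-/

namespace Literature.Combinatorics.SimpleGraph

variable {α : Type*}

/-! ### Rotating cyclic listings -/

namespace IsHamCycleListing

variable {R : α → α → Prop} {l : List α}

/-- **A rotated listing is a listing.** [folklore] -/
theorem rotate (h : IsHamCycleListing R l) (k : ℕ) : IsHamCycleListing R (l.rotate k) := by
  refine ⟨List.nodup_rotate.2 h.nodup, fun v => List.mem_rotate.2 (h.mem v), fun i hi => ?_⟩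
  have hL : (l.rotate k).length = l.length := List.length_rotate l k
  have hl0 : 0 < l.length := by rw [← hL]; omega
  have key : ∀ (j j' : ℕ) (hj : j < l.length) (hj' : j' < l.length),
      j' = (j + 1) % l.length → R l[j] l[j'] := by
    intro j j' hj hj' e; subst e; exact h.rel j hj
  simp only [List.getElem_rotate]
  apply key
  rw [hL, Nat.mod_add_mod, Nat.mod_add_mod, Nat.add_right_comm]

/-- **Any vertex can be rotated to the end.** [folklore] -/
theorem exists_rotate_eq_concat (h : IsHamCycleListing R l) (z : α) :
    ∃ (k : ℕ) (L : List α), l.rotate k = L ++ [z] := by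
  obtain ⟨i, hi, rfl⟩ := List.mem_iff_getElem.1 (h.mem z)
  refine ⟨i + 1, ?_⟩
  rw [← List.getLast?_eq_some_iff, List.getLast?_eq_getElem?, List.length_rotate,
    List.getElem?_eq_getElem (by rw [List.length_rotate]; omega), List.getElem_rotate]
  congr 1
  have e : (l.length - 1 + (i + 1)) % l.length = i := by
    rw [show l.length - 1 + (i + 1) = i + l.length by omega, Nat.add_mod_right, Nat.mod_eq_of_lt hi]
  simp only [e]

end IsHamCycleListing

/-- **Listings ending in `z`**: `L ++ [z]` is a cyclic listing iff it has no duplicates, is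
exhaustive, `L` is a chain, its last entry is related to `z` and `z` to its first entry. [folklore] -/
theorem isHamCycleListing_concat_iff {R : α → α → Prop} {L : List α} {z : α} (hL : L ≠ []) :
    IsHamCycleListing R (L ++ [z]) ↔ (L ++ [z]).Nodup ∧ (∀ v, v ∈ L ++ [z]) ∧ List.IsChain R L ∧
      R (L.getLast hL) z ∧ R z (L.head hL) := by
  rw [isHamCycleListing_iff_isChain, List.isChain_append]
  have h1 : ∀ hl : L ++ [z] ≠ [], (L ++ [z]).getLast hl = z := fun hl => by simp
  have h2 : ∀ hl : L ++ [z] ≠ [], (L ++ [z]).head hl = L.head hL := fun hl =>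
    List.head_append_left hL
  simp only [List.isChain_singleton, true_and, List.head?_cons, Option.mem_def, Option.some.injEq,
    forall_eq', List.getLast?_eq_some_getLast hL, h1, h2]
  constructor
  · rintro ⟨hnd, hall, ⟨hc, hlink⟩, hwrap⟩
    exact ⟨hnd, hall, hc, hlink, hwrap (by simp)⟩
  · rintro ⟨hnd, hall, hc, hlink, hwrap⟩
    exact ⟨hnd, hall, ⟨hc, hlink⟩, fun _ => hwrap⟩

/-- **A vertex with two neighbours is passed between them**: if `z` (last in the listing) is related
only to `p` and `q`, then the path `L` runs from one of them to the other. [cite: GareyJohnson1979, §3.2.2 (degree-two forcing, via Garey–Johnson–Tarjan 1976 §2)] -/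
theorem ends_of_two_nbrs {R : α → α → Prop} {L : List α} {z p q : α} (hL : L ≠ [])
    (h : IsHamCycleListing R (L ++ [z])) (h2 : 2 ≤ L.length)
    (hz : ∀ x, R z x → x = p ∨ x = q) (hz' : ∀ x, R x z → x = p ∨ x = q) :
    (L.head hL = p ∧ L.getLast hL = q) ∨ (L.head hL = q ∧ L.getLast hL = p) := by
  obtain ⟨hnd, -, -, hlast, hhead⟩ := (isHamCycleListing_concat_iff hL).1 h
  have hne : L.head hL ≠ L.getLast hL := by
    rw [List.head_eq_getElem, List.getLast_eq_getElem]
    intro e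
    have := ((List.nodup_append.1 hnd).1.getElem_inj_iff).1 e
    omega
  rcases hz _ hhead with e₁ | e₁ <;> rcases hz' _ hlast with e₂ | e₂
  · exact absurd (e₁.trans e₂.symm) hne
  · exact Or.inl ⟨e₁, e₂⟩
  · exact Or.inr ⟨e₁, e₂⟩
  · exact absurd (e₁.trans e₂.symm) hne

/-! ### Subdividing an edge -/

/-- The relation generating the subdivided graph. [folklore] -/
def subdivideRel (G : _root_.SimpleGraph α) (a c : α) : Option α → Option α → Prop
  | some x, some y => G.Adj x y ∧ ¬ (x = a ∧ y = c) ∧ ¬ (x = c ∧ y = a)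
  | none, some y => y = a ∨ y = c
  | _, _ => False

/-- **The graph `G` with the edge `a — c` subdivided** by the new vertex `none`. [folklore] -/
def subdivide (G : _root_.SimpleGraph α) (a c : α) : _root_.SimpleGraph (Option α) :=
  _root_.SimpleGraph.fromRel (subdivideRel G a c)

section Subdivide

variable {G : _root_.SimpleGraph α} {a c : α}

/-- Adjacency of old vertices: the old edges except `a — c`. [folklore] -/
theorem subdivide_adj_some_some {x y : α} :
    (subdivide G a c).Adj (some x) (some y) ↔ G.Adj x y ∧ ¬ (x = a ∧ y = c) ∧ ¬ (x = c ∧ y = a) := by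
  simp only [subdivide, _root_.SimpleGraph.fromRel_adj, ne_eq, Option.some.injEq, subdivideRel]
  constructor
  · rintro ⟨-, h | h⟩
    · exact h
    · exact ⟨h.1.symm, fun e => h.2.2 ⟨e.2, e.1⟩, fun e => h.2.1 ⟨e.2, e.1⟩⟩
  · intro h
    exact ⟨h.1.ne, Or.inl h⟩

/-- The new vertex is adjacent exactly to `a` and `c`. [folklore] -/
theorem subdivide_adj_none_some {y : α} : (subdivide G a c).Adj none (some y) ↔ y = a ∨ y = c := by
  simp [subdivide, _root_.SimpleGraph.fromRel_adj, subdivideRel]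

/-- The new vertex is adjacent exactly to `a` and `c` (other orientation). [folklore] -/
theorem subdivide_adj_some_none {y : α} : (subdivide G a c).Adj (some y) none ↔ y = a ∨ y = c := by
  rw [_root_.SimpleGraph.adj_comm, subdivide_adj_none_some]

/-- The neighbours of the new vertex. [folklore] -/
theorem subdivide_adj_none_iff {w : Option α} : (subdivide G a c).Adj none w ↔ w = some a ∨ w = some c := by
  cases w with
  | none => simp [subdivide]
  | some y => rw [subdivide_adj_none_some]; simp

/-- Lists without `none` are images of lists. [folklore] -/
theorem exists_map_some_of_none_not_mem : ∀ {L : List (Option α)}, none ∉ L → ∃ M : List α, L = M.map some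
  | [], _ => ⟨[], rfl⟩
  | none :: L, h => (h List.mem_cons_self).elim
  | some x :: L, h => by
    obtain ⟨M, hM⟩ := exists_map_some_of_none_not_mem (L := L) fun h' => h (List.mem_cons_of_mem _ h')
    exact ⟨x :: M, by rw [hM, List.map_cons]⟩

variable [Fintype α] [DecidableEq α]

/-- **Removing the subdivision vertex**: a Hamiltonian cycle of `subdivide G a c` gives one of `G`
(the new vertex sits between `a` and `c`, which are adjacent in `G`). [cite: GareyJohnson1979, §3.2.2] -/
theorem isHamiltonian_of_subdivide (hac : G.Adj a c) (h3 : 3 ≤ Fintype.card α)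
    (hH : (subdivide G a c).IsHamiltonian) : G.IsHamiltonian := by
  classical
  have h3' : 3 ≤ Fintype.card (Option α) := by rw [Fintype.card_option]; omega
  obtain ⟨l₁, hl₁⟩ := (isHamiltonian_iff_of_three_le_card _ h3').1 hH
  -- rotate the new vertex to the end
  obtain ⟨k, L₀, hk⟩ := hl₁.exists_rotate_eq_concat none
  have hl : IsHamCycleListing (subdivide G a c).Adj (L₀ ++ [none]) := hk ▸ hl₁.rotate k
  have hlen : (L₀ ++ [none]).length = Fintype.card α + 1 := by rw [hl.length_eq, Fintype.card_option]
  rw [List.length_append, List.length_singleton] at hlen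
  have hL₀ : L₀ ≠ [] := by rintro rfl; simp at hlen; omega
  -- the old vertices, in order
  have hnone : none ∉ L₀ := fun hm => by
    have := (List.nodup_append.1 hl.nodup).2.2 none hm none (by simp)
    exact this rfl
  obtain ⟨M, rfl⟩ := exists_map_some_of_none_not_mem hnone
  have hM : M ≠ [] := by rintro rfl; exact hL₀ rfl
  obtain ⟨hnd, hall, hch, hlast, hhead⟩ := (isHamCycleListing_concat_iff hL₀).1 hl
  -- its ends are `a` and `c`
  have hends := ends_of_two_nbrs hL₀ hl (by rw [List.length_map] at hlen ⊢; omega)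
    (fun x hx => subdivide_adj_none_iff.1 hx) (fun x hx => subdivide_adj_none_iff.1 hx.symm)
  rw [List.head_map, List.getLast_map, Option.some.injEq, Option.some.injEq, Option.some.injEq,
    Option.some.injEq] at hends
  refine (isHamiltonian_iff_of_three_le_card G h3).2 ⟨M, ?_⟩
  rw [isHamCycleListing_iff_isChain]
  refine ⟨(List.nodup_map_iff (Option.some_injective α)).1 (List.nodup_append.1 hnd).1, fun v => ?_, ?_,
    fun hl' => ?_⟩
  · have := hall (some v)
    simp only [List.mem_append, List.mem_map, Option.some.injEq, exists_eq_right, List.mem_singleton,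
      reduceCtorEq, or_false] at this
    exact this
  · rw [List.isChain_map] at hch
    exact hch.imp fun x y hxy => (subdivide_adj_some_some.1 hxy).1
  · rw [show M.getLast hl' = M.getLast hM from rfl, show M.head hl' = M.head hM from rfl]
    rcases hends with ⟨h1, h2⟩ | ⟨h1, h2⟩
    · rw [h1, h2]; exact hac.symm
    · rw [h1, h2]; exact hac

/-- **Inserting the subdivision vertex**: a Hamiltonian cycle of `G` passes the degree-two vertex `a`
through the edge `a — c`, where the new vertex can be inserted. [cite: GareyJohnson1979, §3.2.2] -/
theorem isHamiltonian_subdivide {a' : α} (ha : ∀ x, G.Adj a x ↔ x = c ∨ x = a') (hca' : c ≠ a')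
    (h3 : 3 ≤ Fintype.card α) (hG : G.IsHamiltonian) : (subdivide G a c).IsHamiltonian := by
  classical
  have hac : G.Adj a c := (ha c).2 (Or.inl rfl)
  have haa' : G.Adj a a' := (ha a').2 (Or.inr rfl)
  have h3' : 3 ≤ Fintype.card (Option α) := by rw [Fintype.card_option]; omega
  obtain ⟨l, hl⟩ := (isHamiltonian_iff_of_three_le_card _ h3).1 hG
  obtain ⟨k, L, hk⟩ := hl.exists_rotate_eq_concat a
  have hla : IsHamCycleListing G.Adj (L ++ [a]) := hk ▸ hl.rotate k
  have hlen : (L ++ [a]).length = Fintype.card α := hla.length_eq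
  rw [List.length_append, List.length_singleton] at hlen
  have hL : L ≠ [] := by rintro rfl; simp at hlen; omega
  obtain ⟨hnd, hall, hch, hlast, hhead⟩ := (isHamCycleListing_concat_iff hL).1 hla
  have haL : a ∉ L := fun hm => (List.nodup_append.1 hnd).2.2 a hm a (by simp) rfl
  -- consecutive old vertices other than `a` stay adjacent
  have hchain : List.IsChain (subdivide G a c).Adj (L.map some) := by
    rw [List.isChain_map]
    refine hch.imp_of_mem_imp fun x y hx hy hxy => subdivide_adj_some_some.2 ⟨hxy, ?_, ?_⟩
    · rintro ⟨rfl, -⟩; exact haL hx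
    · rintro ⟨-, rfl⟩; exact haL hy
  have hnd' : (L.map some).Nodup := (List.nodup_map_iff (Option.some_injective α)).2 (List.nodup_append.1 hnd).1
  have hmemL : ∀ v, v ≠ a → some v ∈ L.map some := fun v hv => by
    have := hall v
    simp only [List.mem_append, List.mem_singleton] at this
    exact List.mem_map.2 ⟨v, this.resolve_right hv, rfl⟩
  have hends := ends_of_two_nbrs hL hla (by omega) (fun x hx => (ha x).1 hx) (fun x hx => (ha x).1 hx.symm)
  refine (isHamiltonian_iff_of_three_le_card _ h3').2 ?_
  rcases hends with ⟨hh, hg⟩ | ⟨hh, hg⟩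
  · -- `c, …, a', a, none`
    refine ⟨(L.map some ++ [some a]) ++ [none], ?_⟩
    rw [isHamCycleListing_concat_iff (by simp)]
    refine ⟨?_, ?_, ?_, ?_, ?_⟩
    · rw [List.nodup_append]
      refine ⟨List.nodup_append.2 ⟨hnd', List.nodup_singleton _, fun x hx y hy => ?_⟩, List.nodup_singleton _,
        fun x hx y hy => ?_⟩
      · rw [List.mem_singleton] at hy; subst hy
        rintro rfl
        obtain ⟨x', hx', e⟩ := List.mem_map.1 hx
        exact haL ((Option.some_injective α e).symm ▸ hx')
      · rw [List.mem_singleton] at hy; subst hy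
        simp only [List.mem_append, List.mem_map, List.mem_singleton] at hx
        rcases hx with ⟨x', -, rfl⟩ | rfl <;> simp
    · rintro (_ | v)
      · simp
      · by_cases hv : v = a
        · subst hv; simp
        · exact List.mem_append_left _ (List.mem_append_left _ (hmemL v hv))
    · refine List.IsChain.append hchain (List.isChain_singleton _) fun x hx y hy => ?_
      rw [List.getLast?_map, List.getLast?_eq_some_getLast hL, Option.map_some, Option.mem_def,
        Option.some.injEq] at hx
      simp only [List.head?_cons, Option.mem_def, Option.some.injEq] at hy
      subst hx; subst hy
      rw [hg]
      exact subdivide_adj_some_some.2 ⟨haa'.symm, fun e => haa'.ne e.1.symm, fun e => hca' e.1.symm⟩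
    · simp [subdivide_adj_some_none]
    · have e1 : (List.map some L ++ [some a]).head (by simp) = some (L.head hL) := by
        cases L with
        | nil => exact absurd rfl hL
        | cons x L' => rfl
      rw [e1, hh]
      exact subdivide_adj_none_some.2 (Or.inr rfl)
  · -- `a', …, c, none, a`
    refine ⟨(L.map some ++ [none]) ++ [some a], ?_⟩
    rw [isHamCycleListing_concat_iff (by simp)]
    refine ⟨?_, ?_, ?_, ?_, ?_⟩
    · rw [List.nodup_append]
      refine ⟨List.nodup_append.2 ⟨hnd', List.nodup_singleton _, fun x hx y hy => ?_⟩, List.nodup_singleton _,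
        fun x hx y hy => ?_⟩
      · rw [List.mem_singleton] at hy; subst hy
        obtain ⟨x', -, rfl⟩ := List.mem_map.1 hx
        simp
      · rw [List.mem_singleton] at hy; subst hy
        simp only [List.mem_append, List.mem_map, List.mem_singleton] at hx
        rcases hx with ⟨x', hx', rfl⟩ | rfl
        · exact fun e => haL ((Option.some_injective α e) ▸ hx')
        · simp
    · rintro (_ | v)
      · simp
      · by_cases hv : v = a
        · subst hv; simp
        · exact List.mem_append_left _ (List.mem_append_left _ (hmemL v hv))
    · refine List.IsChain.append hchain (List.isChain_singleton _) fun x hx y hy => ?_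
      rw [List.getLast?_map, List.getLast?_eq_some_getLast hL, Option.map_some, Option.mem_def,
        Option.some.injEq] at hx
      simp only [List.head?_cons, Option.mem_def, Option.some.injEq] at hy
      subst hx; subst hy
      rw [hg]
      exact subdivide_adj_some_none.2 (Or.inr rfl)
    · simpa using subdivide_adj_none_some.2 (Or.inl rfl)
    · have e1 : (List.map some L ++ [none]).head (by simp) = some (L.head hL) := by
        cases L with
        | nil => exact absurd rfl hL
        | cons x L' => rfl
      rw [e1, hh]
      exact subdivide_adj_some_some.2 ⟨haa', fun e => hca' e.2.symm, fun e => haa'.ne e.2.symm⟩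

/-- **Subdividing a forced edge preserves Hamiltonicity both ways.** [cite: GareyJohnson1979, §3.2.2] -/
theorem isHamiltonian_subdivide_iff {a' : α} (ha : ∀ x, G.Adj a x ↔ x = c ∨ x = a') (hca' : c ≠ a')
    (h3 : 3 ≤ Fintype.card α) : (subdivide G a c).IsHamiltonian ↔ G.IsHamiltonian :=
  ⟨isHamiltonian_of_subdivide ((ha c).2 (Or.inl rfl)) h3, isHamiltonian_subdivide ha hca' h3⟩

end Subdivide

/-! ### Iterated subdivision -/

/-- `r` new vertices: `PadV α r = Option^r α`. [folklore] -/
def PadV (α : Type*) : ℕ → Type _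
  | 0 => α
  | r + 1 => Option (PadV α r)

/-- `PadV α r` is finite. [folklore] -/
instance instFintypePadV [Fintype α] : (r : ℕ) → Fintype (PadV α r)
  | 0 => ‹Fintype α›
  | r + 1 => @instFintypeOption _ (instFintypePadV r)

/-- `PadV α r` has decidable equality. [folklore] -/
instance instDecidableEqPadV [DecidableEq α] : (r : ℕ) → DecidableEq (PadV α r)
  | 0 => ‹DecidableEq α›
  | r + 1 => by haveI := instDecidableEqPadV r; exact inferInstanceAs (DecidableEq (Option (PadV α r)))

/-- `|PadV α r| = |α| + r`. [folklore] -/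
theorem card_padV [Fintype α] : ∀ r : ℕ, Fintype.card (PadV α r) = Fintype.card α + r
  | 0 => rfl
  | r + 1 => by
    show @Fintype.card (Option (PadV α r)) (@instFintypeOption _ (instFintypePadV r)) = _
    rw [@Fintype.card_option _ (instFintypePadV r), card_padV r, Nat.add_assoc]

/-- A graph with a marked edge `a — c` (to be subdivided next) and the other neighbour `a'` of `a`.
[folklore] -/
structure Marked (V : Type*) where
  /-- the graph -/
  G : _root_.SimpleGraph V
  /-- the degree-two end of the marked edge -/
  a : V
  /-- the other end of the marked edge -/
  c : V
  /-- the second neighbour of `a` -/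
  a' : V

/-- One subdivision step: subdivide `a — c`, then mark the edge from the new vertex to `c`. [folklore] -/
def Marked.step {V : Type*} (P : Marked V) : Marked (Option V) :=
  ⟨subdivide P.G P.a P.c, none, some P.c, some P.a⟩

/-- `r` subdivision steps. [folklore] -/
def Marked.iter (P : Marked α) : (r : ℕ) → Marked (PadV α r)
  | 0 => P
  | r + 1 => (P.iter r).step

/-- The marked vertex has exactly the two neighbours `c ≠ a'`. [folklore] -/
def Marked.Good {V : Type*} (P : Marked V) : Prop :=
  (∀ x, P.G.Adj P.a x ↔ x = P.c ∨ x = P.a') ∧ P.c ≠ P.a'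

/-- Goodness is preserved by a subdivision step. [folklore] -/
theorem Marked.Good.step {V : Type*} {P : Marked V} (h : P.Good) : P.step.Good := by
  refine ⟨fun x => ?_, fun e => ?_⟩
  · show (subdivide P.G P.a P.c).Adj none x ↔ x = some P.c ∨ x = some P.a
    rw [subdivide_adj_none_iff, or_comm]
  · have hac : P.G.Adj P.a P.c := (h.1 P.c).2 (Or.inl rfl)
    exact hac.ne (Option.some_injective _ e).symm

/-- Goodness is preserved by iterated subdivision. [folklore] -/
theorem Marked.Good.iter {P : Marked α} (h : P.Good) : ∀ r : ℕ, (P.iter r).Good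
  | 0 => h
  | r + 1 => (Marked.Good.iter h r).step

/-- **The `r`-fold padded graph.** [folklore] -/
def padGraph (P : Marked α) (r : ℕ) : _root_.SimpleGraph (PadV α r) := (P.iter r).G

/-- **Iterated subdivision of a forced edge preserves Hamiltonicity both ways.**
[cite: GareyJohnson1979, §3.2.2] -/
theorem isHamiltonian_padGraph_iff [Fintype α] [DecidableEq α] {P : Marked α} (h : P.Good)
    (h3 : 3 ≤ Fintype.card α) : ∀ r : ℕ, (padGraph P r).IsHamiltonian ↔ P.G.IsHamiltonian
  | 0 => Iff.rfl
  | r + 1 => by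
    have hr := h.iter r
    have h3r : 3 ≤ Fintype.card (PadV α r) := by rw [card_padV]; omega
    rw [← isHamiltonian_padGraph_iff h h3 r]
    exact isHamiltonian_subdivide_iff (G := (P.iter r).G) hr.1 hr.2 h3r

end Literature.Combinatorics.SimpleGraph
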